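import Summits.KontsevichZagierPeriods.KontsevichZagierPeriods.Theorems.RootDecompRelativeModAbsoluteEvenCircleP7

/-! # `RootDecompRelativeModAbsoluteEvenCircleP8` — part 8/10 of the mechanical ≤400-line split of `evB_src3.lean` (sha256 9b9fc462830f2800…)
Source: decomp-kz lens-3 g14 EvenCircle.lean FINAL @ba0f3b57 §K0–§K12 (land/EvenCircleB @954ab641, lint-fixed, §K12 re-pointed at the landed CircleSplit names; critic CLEARED g7-2 l.1388: evenCircleCellClose_holds); --supports stmt-KontsevichZagierPeriods-30572.
Split by census-1 g10 `gen/splitlean.py`: scopes re-opened with their `open`/`variable`/`set_option` context; mathematics and declaration order unchanged. -/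

noncomputable section
open Set MeasureTheory
open Literature.NumberTheory.Transcendental Literature.ModelTheory.ExponentialFields
namespace Summit.KontsevichZagierPeriods.RootDecompRelativeModAbsolute.Rung30571.RegularisedLogLayer.CylLog.Leaf.G13
namespace AngleFold

/-- **Cell fold (even circle kernels).**  On a bounded open `ℚ`-sa `G ⊆ ℝ¹` with the pointwise data, an honest even-circle
family plus its base rep sums to a relation: smooth locus, interval cells with constant derivative signs / sides of `1`, then
`interval_fold_even`. -/
theorem cell_fold_even {G : Set (Fin 1 → ℝ)} (hG : IsSemialgebraic ℚ G) (_hGo : IsOpen G)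
    (hGb : BddBelow (bpt ⁻¹' G)) (hGa : BddAbove (bpt ⁻¹' G)) {l : ℕ} (nn : Fin l → ℕ) {p u : Fin l → (Fin 1 → ℝ) → ℝ}
    (hp : ∀ j, IsSemialgebraicFunOn ℚ G (p j)) (hu : ∀ j, IsSemialgebraicFunOn ℚ G (u j))
    (hu0 : ∀ j, ∀ x ∈ G, 0 ≤ u j x)
    (A : Fin l → KZ.IntegralRep 2) (hAd : ∀ j, (A j).domain = KZlog.band G (fun _ => 0) (u j))
    (hAi : ∀ j, EqOn (A j).integrand (fun z => p j (Fin.init z) * gk (nn j) (z (Fin.last 1))) (A j).domain)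
    (hint : ∀ j, IntegrableOn (fun x => p j x * Gn (nn j) (u j x)) G)
    (A₀ : KZ.IntegralRep 1) (hA₀d : A₀.domain = G) {a₀ : (Fin 1 → ℝ) → ℝ} (hA₀i : EqOn A₀.integrand a₀ G)
    (hzero : ∀ x ∈ G, a₀ x + ∑ j, p j x * Qk (nn j) (u j x) = 0)
    {S : ℕ} (f' : Fin S → Fin l → ℤ) (m : Fin S → ℚ) (q' : Fin S → (Fin 1 → ℝ) → ℝ)
    (hrel : ∀ s, ∀ x ∈ G, ∑ j, (f' s j : ℝ) * Real.arctan (u j x) = (m s : ℝ) * Real.pi)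
    (hbud : ∀ x ∈ G, ∑ s, q' s x * (m s : ℝ) = 0)
    (hpq : ∀ j, ∀ x ∈ G, (-1) ^ (nn j) * p j x = ∑ s, q' s x * (f' s j : ℝ)) :
    KZ.of A₀ + ∑ j, KZ.of (A j) ∈ KZ.relations := by
  classical
  -- the smooth locus
  obtain ⟨G₁, hG₁G, hG₁o, hG₁, husm, hn₁⟩ := exists_open_smooth_subset hG u hu
  obtain ⟨G₀, hG₀G₁, hG₀o, hG₀, hpsm, hn₀⟩ :=
    exists_open_smooth_subset hG₁ p fun j => (hp j).mono hG₁G hG₁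
  have hG₀G : G₀ ⊆ G := hG₀G₁.trans hG₁G
  have hud : ∀ j, ∀ x ∈ G₀, DifferentiableAt ℝ (u j) x := fun j x hx =>
    (((husm j).mono hG₀G₁).differentiableOn (by simp)).differentiableAt (hG₀o.mem_nhds hx)
  have hpc : ∀ j, ContinuousOn (p j) G₀ := fun j => (hpsm j).continuousOn
  have hu₀ : ∀ j, IsSemialgebraicFunOn ℚ G₀ (u j) := fun j => (hu j).mono hG₀G hG₀
  have hp₀ : ∀ j, IsSemialgebraicFunOn ℚ G₀ (p j) := fun j => (hp j).mono hG₀G hG₀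
  have hdus : ∀ j, IsSemialgebraicFunOn ℚ G₀ (du (u j)) := fun j =>
    IsSemialgebraicFunOn.fderiv_apply_single hG₀o (hu₀ j) (hud j) 0
  have hnull : volume (G \ ⋃ _e : Fin 1, G₀) = 0 := by
    rw [Set.iUnion_const]
    refine measure_mono_null (fun x hx => ?_) (measure_union_null hn₁ hn₀)
    by_cases h1 : x ∈ G₁
    · exact Or.inr ⟨h1, hx.2⟩
    · exact Or.inl ⟨hx.1, h1⟩
  refine loc₀ u hu A hAd A₀ hA₀d (fun _ : Fin 1 => G₀) (fun _ => hG₀) (fun _ => hG₀G)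
    (fun e e' h => (h (Subsingleton.elim _ _)).elim) hnull fun _ A' A₀' hA'd hA'i hA₀'d hA₀'i => ?_
  -- sign cells
  have hneg : ∀ j, IsSemialgebraicFunOn ℚ G₀ (fun x => -du (u j) x) := fun j => (hdus j).neg
  have hum1 : ∀ j, IsSemialgebraicFunOn ℚ G₀ (fun x => u j x - 1) := fun j =>
    IsSemialgebraicFunOn.sub_holds (hu₀ j) (saConst_one hG₀)
  set Z : Fin l ⊕ (Fin l ⊕ Fin l) → Set (Fin 1 → ℝ) :=
    Sum.elim (fun j => {x | x ∈ G₀ ∧ du (u j) x < 0})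
      (Sum.elim (fun j => {x | x ∈ G₀ ∧ -du (u j) x < 0}) (fun j => {x | x ∈ G₀ ∧ u j x - 1 < 0}))
    with hZdef
  have hZ : ∀ i, IsSemialgebraic ℚ (Z i) := by
    intro i
    rcases i with j | j | j
    · exact (hdus j).isSemialgebraic_sep_neg
    · exact (hneg j).isSemialgebraic_sep_neg
    · exact (hum1 j).isSemialgebraic_sep_neg
  obtain ⟨B, T, hT, hTdisj, hTnull, hTZ⟩ := interval_cells hG₀ Z hZ
  refine loc₀ u hu₀ A' hA'd A₀' hA₀'d T (fun b => (hT b).1) (fun b => (hT b).2.2.2) hTdisj hTnull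
    fun b A₁ A₀₁ hA₁d hA₁i hA₀₁d hA₀₁i => ?_
  have hTG : T b ⊆ G₀ := (hT b).2.2.2
  have hsgn : ∀ j, (∀ x ∈ T b, du (u j) x = 0) ∨ (∀ x ∈ T b, du (u j) x < 0) ∨ (∀ x ∈ T b, 0 < du (u j) x) := by
    intro j
    rcases hTZ b (Sum.inl j) with h | h
    · exact Or.inr (Or.inl fun x hx => (h hx).2)
    · rcases hTZ b (Sum.inr (Sum.inl j)) with h' | h'
      · refine Or.inr (Or.inr fun x hx => ?_)
        have h2 : -du (u j) x < 0 := (h' hx).2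
        linarith
      · refine Or.inl fun x hx => ?_
        have h1 : ¬ du (u j) x < 0 := fun hlt => Set.disjoint_left.1 h hx ⟨hTG hx, hlt⟩
        have h2 : ¬ -du (u j) x < 0 := fun hlt => Set.disjoint_left.1 h' hx ⟨hTG hx, hlt⟩
        push Not at h1 h2
        linarith
  have hone : ∀ j, (∀ x ∈ T b, u j x ≤ 1) ∨ (∀ x ∈ T b, 1 ≤ u j x) := by
    intro j
    rcases hTZ b (Sum.inr (Sum.inr j)) with h | h
    · refine Or.inl fun x hx => ?_
      have h2 : u j x - 1 < 0 := (h hx).2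
      linarith
    · refine Or.inr fun x hx => ?_
      have h1 : ¬ u j x - 1 < 0 := fun hlt => Set.disjoint_left.1 h hx ⟨hTG hx, hlt⟩
      push Not at h1
      linarith
  have hA₁i' : ∀ j, EqOn (A₁ j).integrand (fun z => p j (Fin.init z) * gk (nn j) (z (Fin.last 1)))
      (A₁ j).domain := fun j z hz => by
    rw [hA₁i j, hA'i j]
    exact hAi j (by rw [hAd j]; rw [hA₁d j] at hz; exact ⟨hG₀G (hTG hz.1), hz.2⟩)
  have hA₀₁i' : EqOn A₀₁.integrand a₀ (T b) := by
    rw [hA₀₁i, hA₀'i]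
    exact hA₀i.mono (hTG.trans hG₀G)
  have hTGpre : bpt ⁻¹' T b ⊆ bpt ⁻¹' G := preimage_mono (hTG.trans hG₀G)
  exact interval_fold_even (hT b).1 (hT b).2.1 (ordConv_of_convex (hT b).2.2.1) (hGb.mono hTGpre) (hGa.mono hTGpre) nn
    (fun j => (hp₀ j).mono hTG (hT b).1)
    (fun j => (hu₀ j).mono hTG (hT b).1) (fun j x hx => hu0 j x (hG₀G (hTG hx))) (fun j x hx => hud j x (hTG hx))
    hsgn hone (fun j => (hpc j).mono hTG) A₁ hA₁d hA₁i' (fun j => (hint j).mono_set (hTG.trans hG₀G))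
    A₀₁ hA₀₁d hA₀₁i' (fun x hx => hzero x (hG₀G (hTG hx))) f' m q'
    (fun s x hx => hrel s x (hG₀G (hTG hx))) (fun x hx => hbud x (hG₀G (hTG hx)))
    (fun j x hx => hpq j x (hG₀G (hTG hx)))

/-! ### §K10 From the residual's raw data to the engine: the rational/transcendental fibre coefficients, the per-index
scaling `s = √κ_i(x)·θ` (rule 2), the base rep, and the MAIN THEOREM for bounded `E`. -/

/-- Local copy of `CircleSplit.sqPoly` (same body): rational part of `∫₀¹ θ^{2j+r}/(1+θ²κ) dθ`. -/
def sqPolyK (r : ℕ) : ℕ → ℝ → ℝ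
  | 0, _ => 0
  | j + 1, κ => (1 / (((2 * j + r : ℕ) : ℝ) + 1) - sqPolyK r j κ) / κ

/-- Local copy of `CircleSplit.sqTrans` (same body): transcendental coefficient of `∫₀¹ θ^{2j+r}/(1+θ²κ) dθ`. -/
def sqTransK (r : ℕ) : ℕ → ℝ → ℝ
  | 0, _ => if r = 0 then 1 else 1 / 2
  | j + 1, κ => -sqTransK r j κ / κ

/-- Auxiliary step `Qk_eq_sqPolyK` (§K10): Qk eq sq Poly K. [bookkeeping] -/
theorem Qk_eq_sqPolyK (n : ℕ) {u : ℝ} (hu : 0 < u) : Qk n u = u ^ (2 * n + 1) * sqPolyK 0 n (u ^ 2) := by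
  induction n with
  | zero => simp [Qk, sqPolyK]
  | succ k ih =>
    simp only [Qk, sqPolyK, ih]
    have hu0 : u ≠ 0 := hu.ne'
    field_simp
    push_cast
    ring

/-- Auxiliary step `sqTransK_zero_sq` (§K10): sq Trans K zero sq. [bookkeeping] -/
theorem sqTransK_zero_sq (n : ℕ) {u : ℝ} (hu : 0 < u) : sqTransK 0 n (u ^ 2) = (-1) ^ n / u ^ (2 * n) := by
  induction n with
  | zero => simp [sqTransK]
  | succ k ih =>
    simp only [sqTransK, ih]
    have hu0 : u ≠ 0 := hu.ne'
    field_simp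
    ring

/-- **Per-index scaling** `s = u(x)·θ` (rule 2): `⟦E × (0,1); c θ^{2n}/(1+θ²u²)⟧ = ⟦band E 0 u; (c/u^{2n+1}) g_n⟧` in `𝒫_KZ`. -/
theorem scale_piece {E : Set (Fin 1 → ℝ)} (hE : IsSemialgebraic ℚ E) (n : ℕ) {c u : (Fin 1 → ℝ) → ℝ}
    (hc : IsSemialgebraicFunOn ℚ E c) (hu : IsSemialgebraicFunOn ℚ E u) (hu0 : ∀ x ∈ E, 0 < u x)
    (hud : ∀ x ∈ E, DifferentiableAt ℝ u x)
    (B : KZ.IntegralRep 2) (hBd : B.domain = {z : Fin 2 → ℝ | Fin.init z ∈ E ∧ z (Fin.last 1) ∈ Ioo (0:ℝ) 1})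
    (hBi : EqOn B.integrand
      (fun z => c (Fin.init z) * (z (Fin.last 1) ^ (2 * n) / (1 + z (Fin.last 1) ^ 2 * u (Fin.init z) ^ 2))) B.domain)
    (hint : IntegrableOn (fun x => c x / u x ^ (2 * n + 1) * Gn n (u x)) E) :
    ∃ A : KZ.IntegralRep 2, A.domain = KZlog.band E (fun _ => 0) u ∧
      A.integrand = (fun z => c (Fin.init z) / u (Fin.init z) ^ (2 * n + 1) * gk n (z (Fin.last 1))) ∧
      cl B = cl A := by
  have hEm : MeasurableSet E := IsSemialgebraic.measurableSet_holds hE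
  have hp : IsSemialgebraicFunOn ℚ E (fun x => c x / u x ^ (2 * n + 1)) :=
    IsSemialgebraicFunOn.div hc (hu.fun_pow _) fun x hx => pow_ne_zero _ (hu0 x hx).ne'
  let A : KZ.IntegralRep 2 := circRep hE hu hp n (fun x hx => (hu0 x hx).le) hint
  refine ⟨A, rfl, rfl, ?_⟩
  have hAd : A.domain = KZlog.band E (fun _ => 0) u := rfl
  have hD : ∀ z, z ∈ B.domain ↔ Fin.init z ∈ E ∧ 0 < z (Fin.last 1) ∧ z (Fin.last 1) < 1 := fun z => by
    rw [hBd]; exact ⟨fun h => ⟨h.1, h.2.1, h.2.2⟩, fun h => ⟨h.1, h.2.1, h.2.2⟩⟩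
  have hBm : MeasurableSet B.domain := IsSemialgebraic.measurableSet_holds B.isSemialgebraic_domain
  -- the open band `P`
  set P : Set (Fin 2 → ℝ) := {w | Fin.init w ∈ E ∧ 0 < w (Fin.last 1) ∧ w (Fin.last 1) < u (Fin.init w)} with hP
  have hB' : IsSemialgebraic ℚ {w : Fin 2 → ℝ | Fin.init w ∈ E} := isSemialgebraic_initMem hE
  have hPsa : IsSemialgebraic ℚ P := by
    have hl : IsSemialgebraicFunOn ℚ {w : Fin 2 → ℝ | Fin.init w ∈ E} (fun w => w (Fin.last 1)) :=
      Literature.NumberTheory.Transcendental.isSemialgebraicFunOn_apply hB' (Fin.last 1)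
    have hs1 : IsSemialgebraicFunOn ℚ {w : Fin 2 → ℝ | Fin.init w ∈ E} (fun w => -w (Fin.last 1)) := hl.neg
    have hs2 : IsSemialgebraicFunOn ℚ {w : Fin 2 → ℝ | Fin.init w ∈ E} (fun w => w (Fin.last 1) - u (Fin.init w)) :=
      IsSemialgebraicFunOn.sub_holds hl hu.comp_init
    have h1 := hs1.isSemialgebraic_sep_neg
    have h2 := hs2.isSemialgebraic_sep_neg
    have hPeq : P = {w | w ∈ {w : Fin 2 → ℝ | Fin.init w ∈ E} ∧ (fun w => -w (Fin.last 1)) w < 0} ∩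
        {w | w ∈ {w : Fin 2 → ℝ | Fin.init w ∈ E} ∧ (fun w => w (Fin.last 1) - u (Fin.init w)) w < 0} := by
      ext w
      simp only [hP, mem_setOf_eq, mem_inter_iff]
      constructor
      · rintro ⟨hx, h1, h2⟩; exact ⟨⟨hx, by linarith⟩, ⟨hx, by linarith⟩⟩
      · rintro ⟨⟨hx, h1⟩, ⟨_, h2⟩⟩; exact ⟨hx, by linarith, by linarith⟩
    rw [hPeq]
    exact h1.inter h2
  have hPA : P ⊆ A.domain := fun w hw => by rw [hAd]; exact ⟨hw.1, hw.2.1.le, hw.2.2.le⟩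
  have hvol : volume (A.domain \ P) = 0 := by
    refine measure_mono_null (fun w hw => ?_)
      (measure_union_null (KZ.volume_setOf_last_eq_zero (n := 1) (0:ℝ)) (KZ.volume_graph_eq_zero hu))
    obtain ⟨hw, hnot⟩ := hw
    rw [hAd] at hw
    obtain ⟨hx, h0, hle⟩ := hw
    by_cases h0' : w (Fin.last 1) = 0
    · exact Or.inl h0'
    · right
      refine ⟨hx, le_antisymm hle ?_⟩
      by_contra hlt
      push Not at hlt
      exact hnot ⟨hx, lt_of_le_of_ne h0 (Ne.symm h0'), hlt⟩
  have r2 : KZ.of A - KZ.of (A.restrict _ hPsa hPA) ∈ KZ.relations := A.of_sub_of_restrict_mem_relations hPsa hPA hvol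
  -- the substitution `s = u(x) θ`
  set ψ : (Fin 2 → ℝ) → ℝ := fun z => u (Fin.init z) * z (Fin.last 1) with hψ
  set ψs : (Fin 2 → ℝ) → ℝ := fun z => u (Fin.init z) with hψs
  have hBE : B.domain ⊆ {w : Fin 2 → ℝ | Fin.init w ∈ E} := fun z hz => ((hD z).1 hz).1
  have hψsa : IsSemialgebraicFunOn ℚ B.domain ψ :=
    ((hu.comp_init.mono hBE B.isSemialgebraic_domain).mul_holds
      (Literature.NumberTheory.Transcendental.isSemialgebraicFunOn_apply B.isSemialgebraic_domain (Fin.last 1)))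
  have hψd : ∀ z ∈ B.domain, DifferentiableAt ℝ ψ z := fun z hz => by
    have h1 : DifferentiableAt ℝ (fun z : Fin 2 → ℝ => Fin.init z) z :=
      differentiableAt_pi.2 fun i => differentiableAt_apply (Fin.castSucc i) z
    exact ((hud _ ((hD z).1 hz).1).comp z h1).mul (differentiableAt_apply (Fin.last 1) z)
  have hψs' : ∀ z ∈ B.domain, HasDerivAt (fun t : ℝ => ψ (Fin.snoc (Fin.init z) t)) (ψs z) (z (Fin.last 1)) :=
    fun z _ => by
    have hfun : (fun t : ℝ => ψ (Fin.snoc (Fin.init z) t)) = fun t => u (Fin.init z) * t := by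
      funext t; simp only [hψ, Fin.init_snoc, Fin.snoc_last]
    rw [hfun]
    simpa using (hasDerivAt_id (z (Fin.last 1))).const_mul (u (Fin.init z))
  have hinj : ∀ z₁ ∈ B.domain, ∀ z₂ ∈ B.domain, Fin.init z₁ = Fin.init z₂ → ψ z₁ = ψ z₂ →
      z₁ (Fin.last 1) = z₂ (Fin.last 1) := fun z₁ h₁ z₂ _ hi he => by
    have hu1 : u (Fin.init z₁) ≠ 0 := (hu0 _ ((hD z₁).1 h₁).1).ne'
    have he' : u (Fin.init z₁) * z₁ (Fin.last 1) = u (Fin.init z₁) * z₂ (Fin.last 1) := by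
      have := he; simp only [hψ] at this; rw [hi] at this ⊢; exact this
    exact mul_left_cancel₀ hu1 he'
  have himage : substMap ψ '' B.domain = P := by
    ext w
    constructor
    · rintro ⟨z, hz, rfl⟩
      obtain ⟨hx, h0, h1⟩ := (hD z).1 hz
      have hux := hu0 _ hx
      refine ⟨by rw [init_substMap]; exact hx, by rw [substMap_last]; exact mul_pos hux h0, ?_⟩
      rw [substMap_last, init_substMap]
      exact mul_lt_of_lt_one_right hux h1
    · rintro ⟨hx, h0, h1⟩
      have hux := hu0 _ hx
      refine ⟨Fin.snoc (Fin.init w) (w (Fin.last 1) / u (Fin.init w)), (hD _).2 ⟨by rw [Fin.init_snoc]; exact hx,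
        by rw [Fin.snoc_last]; exact div_pos h0 hux, by rw [Fin.snoc_last]; exact (div_lt_one hux).2 h1⟩, ?_⟩
      rw [substMap_apply, Fin.init_snoc]
      simp only [hψ, Fin.init_snoc, Fin.snoc_last]
      rw [mul_div_cancel₀ _ hux.ne', Fin.snoc_init_self]
  have r1 : KZ.of B - KZ.of (A.restrict _ hPsa hPA) ∈ KZ.relations := by
    refine of_sub_of_mem_relations_of_subst ψ ψs B (A.restrict _ hPsa hPA) hψsa hψd hψs' hinj himage.symm
      fun z hz => ?_
    obtain ⟨hx, h0, h1⟩ := (hD z).1 hz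
    have hux := hu0 _ hx
    rw [hBi hz]
    show c (Fin.init z) * (z (Fin.last 1) ^ (2 * n) / (1 + z (Fin.last 1) ^ 2 * u (Fin.init z) ^ 2)) =
      c (Fin.init (substMap ψ z)) / u (Fin.init (substMap ψ z)) ^ (2 * n + 1) * gk n (substMap ψ z (Fin.last 1)) * |ψs z|
    rw [init_substMap, substMap_last]
    simp only [hψ, hψs, gk]
    rw [abs_of_pos hux, mul_pow, pow_succ]
    have hun : u (Fin.init z) ^ (2 * n) ≠ 0 := pow_ne_zero _ hux.ne'
    field_simp
    ring
  show mk (KZ.of B) = mk (KZ.of A)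
  rw [mk_sub_eq r1, ← mk_sub_eq r2]

end AngleFold
end Summit.KontsevichZagierPeriods.RootDecompRelativeModAbsolute.Rung30571.RegularisedLogLayer.CylLog.Leaf.G13
end
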